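import Mathlib
import HarnessLib
import Summits.AnomalousDissipation.AnomalousDissipation.Theses.DecimationAxis
import Literature.Analysis.FluidPDE.GalerkinFlow
import Literature.Analysis.FluidPDE.LongTimeAverageShift

/-!
# Stub-ideation k1 for `stub_absorbedWitness` (crux `UniformEquilibration`, route DecimationAxis)

Scratch file: the HELPER LEMMA SIGNATURES of `STUB-IDEAS-stub_absorbedWitness-1.md`, elaborated
(sorried) against the tree, plus the composition `stub_absorbedWitness_of_helpers` showing the
helpers have the right shape to feed the stub. The §0 vocabulary is copied verbatim from
`Cruxes/UniformEquilibration/Lines/birth.lean` (that module is not imported here).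
-/

set_option linter.dupNamespace false

noncomputable section

namespace Summit.AnomalousDissipation.AnomalousDissipation.Cruxes.UniformEquilibration.StubIdeas1

open scoped BigOperators Topology Classical MeasureTheory InnerProductSpace ComplexConjugate
open Filter Set Function MeasureTheory
open Literature.Analysis.FunctionSpaces Literature.Analysis.FunctionSpaces.Torus
open Literature.Analysis.FluidPDE
open Summit.AnomalousDissipation.AnomalousDissipation.Theses.DecimationAxis

local notation "ℤ³" => Fin 3 → ℤ
local notation "ℂ³" => EuclideanSpace ℂ (Fin 3)

/-! ### §0 Vocabulary (verbatim copy of `Lines/birth.lean` §0) -/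

def IsCoeffTrajectory (S : Finset ℤ³) (ν : ℝ) (g : ℤ³ → ℂ³) (c : ℝ → ↥S → ℂ³) : Prop :=
  (∀ t, c t ∈ galerkinSubspace S) ∧ ContinuousOn c (Set.Ici 0) ∧
    ∀ T : ℝ, ∀ t ∈ Set.Icc (0 : ℝ) T,
      HasDerivWithinAt c (galerkinRHS S ν (fun k => g k) (c t)) (Set.Icc 0 T) t

def modalEnergy {S : Finset ℤ³} (a : ↥S → ℂ³) : ℝ :=
  ∑ k : ↥S, ‖a k‖ ^ 2

def resolvedDissipation {S : Finset ℤ³} (ν : ℝ) (M : ℕ) (a : ↥S → ℂ³) : ℝ :=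
  ν * (4 * Real.pi ^ 2 * ∑ k : ↥S,
    if freqNormSq (k : ℤ³) ≤ (M : ℝ) ^ 2 then freqNormSq (k : ℤ³) * ‖a k‖ ^ 2 else 0)

def Sig.stub_absorbedWitness : Prop :=
  ∀ (ν : ℝ), 0 < ν → ∀ (N : ℕ) (g : ℤ³ → ℂ³), IsConjSymm g → (∀ k, k ∉ freqBall N → g k = 0) →
    g 0 = 0 → (∀ k : ℤ³, ∑ i, ((k i : ℤ) : ℂ) * g k i = 0) →
    ∃ B : ℝ, ∀ (E ε : ℝ) (M K : ℕ) (S : Finset ℤ³), S = (freqBall K).erase 0 →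
      (∃ c : ℝ → ↥S → ℂ³, IsCoeffTrajectory S ν g c ∧
          longTimeAvgSup (fun t => modalEnergy (c t)) ≤ E ∧
          2 * ε ≤ longTimeAvgInf (fun t => resolvedDissipation ν M (c t))) →
      ∃ c : ℝ → ↥S → ℂ³, IsCoeffTrajectory S ν g c ∧ (∀ t, 0 ≤ t → modalEnergy (c t) ≤ B) ∧
          longTimeAvgSup (fun t => modalEnergy (c t)) ≤ E ∧
          2 * ε ≤ longTimeAvgInf (fun t => resolvedDissipation ν M (c t))

/-! ### §1 Helper lemmas of Plan A (negative-rate Grönwall absorbing ball + shift twins) -/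

/-- H0 (XS, dictionary). The crux's trajectory notion is the tree's `IsGalerkinODESolution`
from the datum `c 0` (the only extra field of the structure is `initial : c 0 = c 0`). -/
theorem isCoeffTrajectory_iff {S : Finset ℤ³} {ν : ℝ} {g : ℤ³ → ℂ³} {c : ℝ → ↥S → ℂ³} :
    IsCoeffTrajectory S ν g c ↔ IsGalerkinODESolution ν (fun k : ↥S => g k) (c 0) c :=
  ⟨fun h => ⟨rfl, h.1, h.2.1, h.2.2⟩, fun h => ⟨h.mem, h.continuousOn, h.hasDerivWithinAt⟩⟩

/-- H1 (XS). The punctured truncation ball is symmetric and misses the mean mode. -/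
theorem erase_freqBall_symm_and_zero_not_mem (K : ℕ) :
    (∀ k ∈ (freqBall (d := Fin 3) K).erase 0, -k ∈ (freqBall (d := Fin 3) K).erase 0) ∧
      (0 : ℤ³) ∉ (freqBall (d := Fin 3) K).erase 0 := by
  refine ⟨fun k hk => ?_, by simp⟩
  rw [Finset.mem_erase] at hk ⊢
  exact ⟨neg_ne_zero.2 hk.1, neg_mem_freqBall_of_mem k hk.2⟩

/-- H5 (XS). The force mass seen by `S` is bounded by the `K`-independent constant
`Γ_N = Σ_{k ∈ freqBall N} ‖g k‖²`. -/
theorem sum_norm_sq_coe_le_sum_freqBall {N : ℕ} {g : ℤ³ → ℂ³}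
    (hsupp : ∀ k, k ∉ freqBall N → g k = 0) (S : Finset ℤ³) :
    ∑ k : ↥S, ‖g k‖ ^ 2 ≤ ∑ k ∈ freqBall N, ‖g k‖ ^ 2 := by
  rw [Finset.sum_coe_sort S (fun k => ‖g k‖ ^ 2),
    ← Finset.sum_filter_add_sum_filter_not S (fun k => k ∈ freqBall N)]
  have hz : ∑ k ∈ S.filter (fun k => ¬ k ∈ freqBall N), ‖g k‖ ^ 2 = 0 :=
    Finset.sum_eq_zero fun k hk => by
      rw [hsupp k (Finset.mem_filter.1 hk).2, norm_zero, zero_pow two_ne_zero]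
  rw [hz, add_zero]
  exact Finset.sum_le_sum_of_subset_of_nonneg (fun k hk => (Finset.mem_filter.1 hk).2)
    fun _ _ _ => sq_nonneg _

/-- H2 (S). Slice inequality: Parseval (`toReal_eGradNormSq_realTrigPoly`,
`integral_inner_realTrigPoly_realTrigPoly`), lattice Poincaré `|k|² ≥ 1` on `S ∌ 0`
(`one_le_freqNormSq_of_ne_zero`) and Young `2 Re⟪g_k, c_k⟫ ≤ ‖g_k‖²/(4π²ν) + 4π²ν‖c_k‖²`
give `ė ≤ -4π²ν·e + Γ/(4π²ν)` (sharpening of the tree's `energy_deriv_le`). -/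
theorem energy_flux_le_neg_rate {S : Finset ℤ³} (hS : ∀ k ∈ S, -k ∈ S) (h0 : (0 : ℤ³) ∉ S)
    {ν : ℝ} (hν : 0 < ν) {g c : ↥S → ℂ³} (hg : IsRealCoeff g) (hc : c ∈ galerkinSubspace S)
    {Γ : ℝ} (hΓ : ∑ k, ‖g k‖ ^ 2 ≤ Γ) :
    2 * (-(ν * (eGradNormSq (realTrigPoly S (coeffExt S c))).toReal) +
        ∫ x, ⟪realTrigPoly S (coeffExt S g) x, realTrigPoly S (coeffExt S c) x⟫_ℝ) ≤
      -(4 * Real.pi ^ 2 * ν) * ∑ k, ‖c k‖ ^ 2 + Γ / (4 * Real.pi ^ 2 * ν) := by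
  sorry

/-- H3 (M, the literature match: FMRT 2001 (A.41)–(A.42); CF 1988 (8.7)–(8.9)). Uniform-in-`S`
Grönwall decay of the modal energy: feed H2 through `hasDerivWithinAt_energy` into Mathlib's
`le_gronwallBound_of_liminf_deriv_right_le` with `K = -4π²ν`, `ε = Γ/(4π²ν)`, exactly as the
tree's `energy_apriori_bound` does with `K = 1`, then bound `gronwallBound` (`gronwallBound_of_K_ne_0`). -/
theorem modalEnergy_le_exp_decay {S : Finset ℤ³} (hS : ∀ k ∈ S, -k ∈ S) (h0 : (0 : ℤ³) ∉ S)
    {ν : ℝ} (hν : 0 < ν) {g c₀ : ↥S → ℂ³} (hg : IsRealCoeff g) {α : ℝ → ↥S → ℂ³}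
    (hα : IsGalerkinODESolution ν g c₀ α) {Γ : ℝ} (hΓ : ∑ k, ‖g k‖ ^ 2 ≤ Γ) {t : ℝ}
    (ht : 0 ≤ t) :
    ∑ k, ‖α t k‖ ^ 2 ≤ (∑ k, ‖c₀ k‖ ^ 2) * Real.exp (-(4 * Real.pi ^ 2 * ν) * t) +
      Γ / (4 * Real.pi ^ 2 * ν) ^ 2 := by
  sorry

/-- H4 (S/M, the missing twin of `longTimeAvgSup_comp_add_right`). For a nonnegative locally
integrable observable BOUNDED on `[0, ∞)`, the `liminf` long-time average does not see a time
shift: `timeMean (φ(·+s)) T - timeMean φ (T+s) = (s/T)·timeMean φ (T+s) - T⁻¹∫₀ˢφ → 0`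
(`timeMean_comp_add_right`, `|timeMean φ| ≤ C`), and `liminf` along `atTop` is invariant under
`T ↦ T + s` and under an additive `o(1)` perturbation. Boundedness sidesteps the junk branch. -/
theorem longTimeAvgInf_comp_add_right_of_bounded {φ : ℝ → ℝ} {s C : ℝ} (hφ : ∀ t, 0 ≤ φ t)
    (hC : ∀ t, 0 ≤ t → φ t ≤ C) (hs : 0 ≤ s)
    (hint : ∀ a b, 0 ≤ a → a ≤ b → IntervalIntegrable φ volume a b) :
    longTimeAvgInf (fun t => φ (t + s)) = longTimeAvgInf φ := by
  sorry

/-- H6 (XS). The resolved dissipation is dominated by the energy: `D_M ≤ ν·4π²M²·e`. -/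
theorem resolvedDissipation_le_modalEnergy {S : Finset ℤ³} {ν : ℝ} (hν : 0 ≤ ν) (M : ℕ)
    (a : ↥S → ℂ³) :
    resolvedDissipation ν M a ≤ ν * (4 * Real.pi ^ 2 * (M : ℝ) ^ 2) * modalEnergy a := by
  unfold resolvedDissipation modalEnergy
  have hterm : ∀ k : ↥S, (if freqNormSq (k : ℤ³) ≤ (M : ℝ) ^ 2 then
      freqNormSq (k : ℤ³) * ‖a k‖ ^ 2 else 0) ≤ (M : ℝ) ^ 2 * ‖a k‖ ^ 2 := by
    intro k
    split_ifs with h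
    · exact mul_le_mul_of_nonneg_right h (sq_nonneg _)
    · positivity
  calc ν * (4 * Real.pi ^ 2 * ∑ k : ↥S, (if freqNormSq (k : ℤ³) ≤ (M : ℝ) ^ 2 then
          freqNormSq (k : ℤ³) * ‖a k‖ ^ 2 else 0))
      ≤ ν * (4 * Real.pi ^ 2 * ∑ k : ↥S, (M : ℝ) ^ 2 * ‖a k‖ ^ 2) := by
        gcongr with k
        exact hterm k
    _ = ν * (4 * Real.pi ^ 2 * (M : ℝ) ^ 2) * ∑ k, ‖a k‖ ^ 2 := by
        rw [← Finset.mul_sum]; ring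

/-- H7 (XS). Both observables are continuous on `[0, ∞)` along a trajectory, hence interval
integrable on every `[a, b] ⊆ [0, ∞)` (`ContinuousOn.intervalIntegrable`). -/
theorem intervalIntegrable_observables {S : Finset ℤ³} {ν : ℝ} {g : ℤ³ → ℂ³}
    {c : ℝ → ↥S → ℂ³} (hc : IsCoeffTrajectory S ν g c) (M : ℕ) {a b : ℝ} (ha : 0 ≤ a)
    (hab : a ≤ b) :
    IntervalIntegrable (fun t => modalEnergy (c t)) volume a b ∧
      IntervalIntegrable (fun t => resolvedDissipation ν M (c t)) volume a b := by
  have hcont : ContinuousOn c (Set.uIcc a b) := by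
    rw [Set.uIcc_of_le hab]
    exact hc.2.1.mono fun t ht => ha.trans ht.1
  have hk : ∀ k : ↥S, ContinuousOn (fun t => ‖c t k‖ ^ 2) (Set.uIcc a b) := fun k =>
    (((continuous_apply k).comp_continuousOn hcont).norm).pow 2
  have hE : ContinuousOn (fun t => modalEnergy (c t)) (Set.uIcc a b) := by
    unfold modalEnergy
    exact continuousOn_finsetSum _ fun k _ => hk k
  have hD : ContinuousOn (fun t => resolvedDissipation ν M (c t)) (Set.uIcc a b) := by
    unfold resolvedDissipation
    refine continuousOn_const.mul (continuousOn_const.mul (continuousOn_finsetSum _ fun k _ => ?_))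
    by_cases h : freqNormSq (k : ℤ³) ≤ (M : ℝ) ^ 2
    · simp only [if_pos h]
      exact continuousOn_const.mul (hk k)
    · simp only [if_neg h]
      exact continuousOn_const
  exact ⟨hE.intervalIntegrable, hD.intervalIntegrable⟩

/-! ### §2 Shape check: the helpers feed the stub (assembly left to the stub prover; the term
below only records the intended constants). -/

/-- The `K`-uniform radius: `B = Γ_N/(4π²ν)² + 1`, `Γ_N = Σ_{k∈freqBall N}‖g k‖²`. -/
def ballRadius (ν : ℝ) (N : ℕ) (g : ℤ³ → ℂ³) : ℝ :=
  (∑ k ∈ freqBall N, ‖g k‖ ^ 2) / (4 * Real.pi ^ 2 * ν) ^ 2 + 1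

/-- The entrance time of a trajectory with datum energy `e₀`: `s = e₀/(4π²ν)`, so that
`e₀·exp(-4π²ν s) = e₀·exp(-e₀) ≤ 1` (`Real.add_one_le_exp`). -/
def entranceTime (ν e₀ : ℝ) : ℝ := e₀ / (4 * Real.pi ^ 2 * ν)

/-- The elementary inequality behind the entrance time. -/
theorem mul_exp_neg_le_one (x : ℝ) : x * Real.exp (-x) ≤ 1 := by
  have h := Real.add_one_le_exp x
  have hpos := Real.exp_pos (-x)
  have : x * Real.exp (-x) ≤ Real.exp x * Real.exp (-x) :=
    mul_le_mul_of_nonneg_right (by linarith) hpos.le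
  simpa [← Real.exp_add] using this

/-! ### §3 Composition: the seven helpers imply the stub (Plan A assembly, kernel-checked modulo
the sorried helpers H2–H5, H7). Constants: `B = Γ_N/(4π²ν)² + 1`, entrance time `s = e₀/(4π²ν)`. -/

theorem stub_absorbedWitness_of_helpers : Sig.stub_absorbedWitness := by
  intro ν hν N g hcs hsupp _hg0 _htr
  obtain ⟨Γ, hΓdef⟩ : ∃ Γ : ℝ, Γ = ∑ k ∈ freqBall N, ‖g k‖ ^ 2 := ⟨_, rfl⟩
  have hL : 0 < 4 * Real.pi ^ 2 * ν := by positivity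
  refine ⟨Γ / (4 * Real.pi ^ 2 * ν) ^ 2 + 1, ?_⟩
  rintro E ε M K S hS ⟨c, hc, hsup, hinf⟩
  obtain ⟨hsym, h0⟩ : (∀ k ∈ S, -k ∈ S) ∧ (0 : ℤ³) ∉ S := by
    subst hS; exact erase_freqBall_symm_and_zero_not_mem K
  have hsol : IsGalerkinODESolution ν (fun k : ↥S => g k) (c 0) c := isCoeffTrajectory_iff.1 hc
  have hgr : IsRealCoeff (S := S) (fun k : ↥S => g k) := isRealCoeff_restrict hcs
  have hΓ : ∑ k : ↥S, ‖g k‖ ^ 2 ≤ Γ := by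
    rw [hΓdef]; exact sum_norm_sq_coe_le_sum_freqBall hsupp S
  obtain ⟨e₀, he₀⟩ : ∃ e : ℝ, e = ∑ k, ‖c 0 k‖ ^ 2 := ⟨_, rfl⟩
  have he₀nn : 0 ≤ e₀ := he₀ ▸ Finset.sum_nonneg fun k _ => sq_nonneg _
  obtain ⟨s, hsdef⟩ : ∃ s : ℝ, s = e₀ / (4 * Real.pi ^ 2 * ν) := ⟨_, rfl⟩
  have hs : 0 ≤ s := hsdef ▸ div_nonneg he₀nn hL.le
  have hLs : -(4 * Real.pi ^ 2 * ν) * s = -e₀ := by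
    rw [hsdef]; field_simp
  -- uniform Grönwall decay along the premise trajectory (H3 fed by H2, H5)
  have hdecay : ∀ t, 0 ≤ t → modalEnergy (c t) ≤
      e₀ * Real.exp (-(4 * Real.pi ^ 2 * ν) * t) + Γ / (4 * Real.pi ^ 2 * ν) ^ 2 := by
    intro t ht
    rw [he₀]
    exact modalEnergy_le_exp_decay hsym h0 hν hgr hsol hΓ ht
  have hE0 : ∀ t, 0 ≤ modalEnergy (c t) := fun t =>
    Finset.sum_nonneg fun k _ => sq_nonneg ‖c t k‖
  have hD0 : ∀ t, 0 ≤ resolvedDissipation ν M (c t) := fun t => by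
    unfold resolvedDissipation
    refine mul_nonneg hν.le (mul_nonneg (by positivity) (Finset.sum_nonneg fun k _ => ?_))
    split_ifs
    · exact mul_nonneg (freqNormSq_nonneg _) (sq_nonneg _)
    · exact le_rfl
  -- the dissipation observable is bounded on `[0, ∞)` (H6 + decay), as H4 requires
  have hDC : ∀ t, 0 ≤ t → resolvedDissipation ν M (c t) ≤
      ν * (4 * Real.pi ^ 2 * (M : ℝ) ^ 2) * (e₀ + Γ / (4 * Real.pi ^ 2 * ν) ^ 2) := by
    intro t ht
    refine (resolvedDissipation_le_modalEnergy hν.le M (c t)).trans ?_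
    refine mul_le_mul_of_nonneg_left ((hdecay t ht).trans ?_) (by positivity)
    have hexp : Real.exp (-(4 * Real.pi ^ 2 * ν) * t) ≤ 1 :=
      Real.exp_le_one_iff.2 (by nlinarith [mul_nonneg hL.le ht])
    nlinarith [mul_le_mul_of_nonneg_left hexp he₀nn]
  -- the shifted witness `c' τ = c (τ + s)` (autonomy: `IsGalerkinODESolution.comp_add`)
  have hsol' := hsol.comp_add hs
  refine ⟨fun τ => c (τ + s), ?_, ?_, ?_, ?_⟩
  · rw [isCoeffTrajectory_iff]
    convert hsol' using 2
    simp
  · -- inside the ball for all `τ ≥ 0`: `e₀·e^{-4π²ν(τ+s)} ≤ e₀·e^{-e₀} ≤ 1`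
    intro t ht
    have h1 := hdecay (t + s) (add_nonneg ht hs)
    have h2 : e₀ * Real.exp (-(4 * Real.pi ^ 2 * ν) * (t + s)) ≤
        e₀ * Real.exp (-(4 * Real.pi ^ 2 * ν) * s) :=
      mul_le_mul_of_nonneg_left (Real.exp_le_exp.2 (by nlinarith [mul_nonneg hL.le ht])) he₀nn
    rw [hLs] at h2
    have h4 : e₀ * Real.exp (-e₀) ≤ 1 := mul_exp_neg_le_one e₀
    show modalEnergy (c (t + s)) ≤ Γ / (4 * Real.pi ^ 2 * ν) ^ 2 + 1
    linarith
  · -- energy `limsup` average: tree lemma `longTimeAvgSup_comp_add_right`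
    have key := longTimeAvgSup_comp_add_right (φ := fun t => modalEnergy (c t)) (s := s) hE0 hs
      (fun a b ha hab => (intervalIntegrable_observables hc M ha hab).1)
    exact (le_of_eq key).trans hsup
  · -- dissipation `liminf` average: the twin H4 (bounded observable)
    have key := longTimeAvgInf_comp_add_right_of_bounded
      (φ := fun t => resolvedDissipation ν M (c t)) (s := s) hD0 hDC hs
      (fun a b ha hab => (intervalIntegrable_observables hc M ha hab).2)
    exact hinf.trans (le_of_eq key.symm)

end Summit.AnomalousDissipation.AnomalousDissipation.Cruxes.UniformEquilibration.StubIdeas1
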